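import Mathlib

/-!
# Crux `BinomialElusive.BinomialCandidate` (stmt-ValiantsHypothesis-7392), line `registered` —
# stub `stub_shallowCorankOne` (skeleton v5, wave 2), piece 3b: leading form of the eliminant

This file proves the registered helper stub `corankOne_eliminantLeadingForm`.  PURE ALGEBRA.
Let `A := ℂ⟦W_0, …, W_{m-1}⟧` (`MvPowerSeries (Fin m) ℂ`) and `F₀, F₁ ∈ A⟦X⟧`,
`F_a = Σ_j f_{a,j} X^j`, with `f_{a,j}(0) = 0` for `j < d` (`a = 0, 1`), `c₀ := f_{0,d}(0) ≠ 0`,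
`c₁ := f_{1,d}(0)`.  Suppose a `d × d` matrix `M` over `A` and `Q_j ∈ A⟦X⟧` satisfy the division
identities `X^j F₁ = Q_j F₀ + Σ_l C(M_{lj}) X^l` (`j < d`).  Then `det M (0) = 0` and, for every
variable `W_i`, `coeff_{W_i^d}(det M) · c₀^d = (c₀ λ_i(f_{1,0}) - c₁ λ_i(f_{0,0}))^d`
(`λ_i` = coefficient of `W_i`).

Proof.  Restrict to the `W_i`-axis: `ρ : A → ℂ⟦w⟧`, `ρ f = Σ_n coeff_{W_i^n}(f) wⁿ`, is a ring
homomorphism compatible with every hypothesis and conclusion (`RingHom.map_det`), so we may replace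
`A` by `B := ℂ⟦w⟧` (`CorankOneLeadingForm.oneVariable`).  Over `B⟦X⟧`:
* reducing mod `w` (`π₀`), `F₀ ↦ X^d u`, `F₁ ↦ X^d v` with `u(0) = c₀ ≠ 0`, `v(0) = c₁`, and the
  remainder `Σ_l M_{lj}(0) X^l = X^d (X^j v - π₀(Q_j) u)` has `X`-degree `< d`, so all
  `M_{lj}(0) = 0` and `π₀(Q_j) = X^j v u⁻¹`;
* taking `w`-linear parts (`π`, Leibniz rule `π(FG) = π₀(F) π(G) + π(F) π₀(G)`),
  `X^j π(F₁) = X^j v u⁻¹ π(F₀) + X^d π(Q_j) u + Σ_l [w¹]M_{lj} X^l`, so the matrix of linear parts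
  `E_{lj} := [w¹] M_{lj}` vanishes for `l < j` and `E_{jj} = L := λ(f_{1,0}) - c₁ c₀⁻¹ λ(f_{0,0})`;
* `M = w • N`, so `det M = w^d det N`, `det M (0) = 0` and `[w^d] det M = det N (0) = det E = L^d`
  (`Matrix.det_of_lowerTriangular`).
Mathlib only.
-/

-- layout Summits/ValiantsHypothesis/ValiantsHypothesis forces the duplicated namespace component
set_option linter.dupNamespace false

namespace Summit.ValiantsHypothesis.ValiantsHypothesis.Theorems.BinomialCandidateStubs

open scoped BigOperators

namespace CorankOneLeadingForm

/-! ## Coefficient helpers in `R⟦X⟧` -/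

section Coeff

variable {R : Type*} [CommSemiring R]

/-- Coefficients below `k` of `X^k p` vanish. -/
theorem coeff_X_pow_mul_of_lt (p : PowerSeries R) {n k : ℕ} (h : n < k) :
    PowerSeries.coeff n (PowerSeries.X ^ k * p) = 0 := by
  rw [PowerSeries.coeff_X_pow_mul', if_neg (not_le.mpr h)]

/-- The `X^k`-coefficient of `X^k p` is `p(0)`. -/
theorem coeff_X_pow_mul_self (p : PowerSeries R) (k : ℕ) :
    PowerSeries.coeff k (PowerSeries.X ^ k * p) = PowerSeries.constantCoeff p := by
  rw [← PowerSeries.coeff_zero_eq_constantCoeff_apply, ← PowerSeries.coeff_X_pow_mul p k 0,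
    zero_add]

/-- The `X^l`-coefficient of a remainder `Σ_{l'} C(c_{l'}) X^{l'}` is `c_l`. -/
theorem coeff_sum_C_mul_X_pow {d : ℕ} (c : Fin d → R) (l : Fin d) :
    PowerSeries.coeff (l : ℕ) (∑ l' : Fin d, PowerSeries.C (c l') * PowerSeries.X ^ (l' : ℕ)) =
      c l := by
  rw [map_sum, Finset.sum_eq_single l]
  · rw [PowerSeries.coeff_C_mul_X_pow, if_pos rfl]
  · intro l' _ hl'
    rw [PowerSeries.coeff_C_mul_X_pow, if_neg]
    exact fun h => hl' (Fin.ext h).symm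
  · exact fun h => absurd (Finset.mem_univ l) h

/-- `X¹`-coefficient of a product. -/
theorem coeff_one_mul (φ ψ : PowerSeries R) :
    PowerSeries.coeff 1 (φ * ψ) =
      PowerSeries.coeff 0 φ * PowerSeries.coeff 1 ψ +
        PowerSeries.coeff 1 φ * PowerSeries.coeff 0 ψ := by
  rw [PowerSeries.coeff_mul, Finset.Nat.sum_antidiagonal_eq_sum_range_succ_mk]
  simp [Finset.sum_range_succ]

end Coeff

/-! ## Restriction to the `W_i`-axis -/

/-- The restriction `ρ_i : ℂ⟦W⟧ → ℂ⟦w⟧` to the `W_i`-axis, `ρ_i f = Σ_n coeff_{W_i^n}(f) wⁿ`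
(all other variables set to `0`), exists as a ring homomorphism. -/
theorem exists_axisHom {m : ℕ} (i : Fin m) :
    ∃ ρ : MvPowerSeries (Fin m) ℂ →+* PowerSeries ℂ,
      ∀ f n, PowerSeries.coeff n (ρ f) = MvPowerSeries.coeff (Finsupp.single i n) f := by
  let ρ : MvPowerSeries (Fin m) ℂ →+* PowerSeries ℂ :=
    { toFun := fun f => PowerSeries.mk fun n => MvPowerSeries.coeff (Finsupp.single i n) f
      map_one' := by
        refine PowerSeries.ext fun n => ?_
        simp only [PowerSeries.coeff_mk, MvPowerSeries.coeff_one, PowerSeries.coeff_one,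
          Finsupp.single_eq_zero]
      map_mul' := by
        intro f g
        refine PowerSeries.ext fun n => ?_
        simp only [PowerSeries.coeff_mk, MvPowerSeries.coeff_mul, Finsupp.antidiagonal_single,
          Finset.sum_map, Function.Embedding.coe_prodMap, Function.Embedding.coeFn_mk,
          Prod.map_fst, Prod.map_snd, PowerSeries.coeff_mul]
      map_zero' := PowerSeries.ext fun n => by simp
      map_add' := fun f g => PowerSeries.ext fun n => by simp }
  refine ⟨ρ, fun f n => ?_⟩
  show PowerSeries.coeff n (PowerSeries.mk fun n => MvPowerSeries.coeff (Finsupp.single i n) f) = _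
  exact PowerSeries.coeff_mk _ _

/-- `ρ_i` preserves constant coefficients. -/
theorem axisHom_constantCoeff {m : ℕ} {i : Fin m} (ρ : MvPowerSeries (Fin m) ℂ →+* PowerSeries ℂ)
    (hρ : ∀ f n, PowerSeries.coeff n (ρ f) = MvPowerSeries.coeff (Finsupp.single i n) f)
    (f : MvPowerSeries (Fin m) ℂ) :
    PowerSeries.constantCoeff (ρ f) = MvPowerSeries.constantCoeff f := by
  rw [← PowerSeries.coeff_zero_eq_constantCoeff_apply, hρ, Finsupp.single_zero,
    MvPowerSeries.coeff_zero_eq_constantCoeff_apply]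

/-! ## Reduction mod `w` and `w`-linear parts on `ℂ⟦w⟧⟦X⟧` -/

/-- Coefficientwise reduction mod `w`, `π₀ : ℂ⟦w⟧⟦X⟧ → ℂ⟦X⟧` (`= PowerSeries.map constantCoeff`). -/
theorem exists_modW :
    ∃ π₀ : PowerSeries (PowerSeries ℂ) →+* PowerSeries ℂ,
      (∀ F n, PowerSeries.coeff n (π₀ F) = PowerSeries.constantCoeff (PowerSeries.coeff n F)) ∧
        π₀ PowerSeries.X = PowerSeries.X ∧
          ∀ a, π₀ (PowerSeries.C a) = PowerSeries.C (PowerSeries.constantCoeff a) :=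
  ⟨PowerSeries.map PowerSeries.constantCoeff, fun F n => PowerSeries.coeff_map _ n F,
    PowerSeries.map_X _, fun a => PowerSeries.map_C _ a⟩

/-- The coefficientwise `w`-linear part `π : ℂ⟦w⟧⟦X⟧ → ℂ⟦X⟧`, `Σ_n F_n(w) Xⁿ ↦ Σ_n [w¹]F_n Xⁿ`,
exists as an additive map. -/
theorem exists_linPart :
    ∃ π : PowerSeries (PowerSeries ℂ) →+ PowerSeries ℂ,
      ∀ F n, PowerSeries.coeff n (π F) = PowerSeries.coeff 1 (PowerSeries.coeff n F) := by
  let π : PowerSeries (PowerSeries ℂ) →+ PowerSeries ℂ :=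
    { toFun := fun F => PowerSeries.mk fun n => PowerSeries.coeff 1 (PowerSeries.coeff n F)
      map_zero' := PowerSeries.ext fun n => by simp
      map_add' := fun F G => PowerSeries.ext fun n => by simp }
  refine ⟨π, fun F n => ?_⟩
  show PowerSeries.coeff n (PowerSeries.mk fun n => PowerSeries.coeff 1 (PowerSeries.coeff n F)) = _
  exact PowerSeries.coeff_mk _ _

/-- Leibniz rule for the linear part: `π(FG) = π₀(F) π(G) + π(F) π₀(G)`. -/
theorem linPart_mul (π₀ : PowerSeries (PowerSeries ℂ) →+* PowerSeries ℂ)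
    (hπ₀ : ∀ F n, PowerSeries.coeff n (π₀ F) = PowerSeries.constantCoeff (PowerSeries.coeff n F))
    (π : PowerSeries (PowerSeries ℂ) →+ PowerSeries ℂ)
    (hπ : ∀ F n, PowerSeries.coeff n (π F) = PowerSeries.coeff 1 (PowerSeries.coeff n F))
    (F G : PowerSeries (PowerSeries ℂ)) :
    π (F * G) = π₀ F * π G + π F * π₀ G := by
  refine PowerSeries.ext fun n => ?_
  rw [hπ, map_add, PowerSeries.coeff_mul n F G, PowerSeries.coeff_mul n (π₀ F) (π G),
    PowerSeries.coeff_mul n (π F) (π₀ G), map_sum, ← Finset.sum_add_distrib]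
  refine Finset.sum_congr rfl fun p _ => ?_
  rw [coeff_one_mul, hπ₀, hπ₀, hπ, hπ, PowerSeries.coeff_zero_eq_constantCoeff_apply,
    PowerSeries.coeff_zero_eq_constantCoeff_apply]

/-- The linear part commutes with multiplication by `X^k`. -/
theorem linPart_X_pow_mul (π : PowerSeries (PowerSeries ℂ) →+ PowerSeries ℂ)
    (hπ : ∀ F n, PowerSeries.coeff n (π F) = PowerSeries.coeff 1 (PowerSeries.coeff n F))
    (k : ℕ) (F : PowerSeries (PowerSeries ℂ)) :
    π (PowerSeries.X ^ k * F) = PowerSeries.X ^ k * π F := by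
  refine PowerSeries.ext fun n => ?_
  rw [hπ, PowerSeries.coeff_X_pow_mul', PowerSeries.coeff_X_pow_mul']
  split_ifs
  · rw [hπ]
  · exact map_zero _

/-- The linear part of a remainder `Σ_l C(c_l) X^l`. -/
theorem linPart_sum_C_mul_X_pow (π : PowerSeries (PowerSeries ℂ) →+ PowerSeries ℂ)
    (hπ : ∀ F n, PowerSeries.coeff n (π F) = PowerSeries.coeff 1 (PowerSeries.coeff n F))
    {d : ℕ} (c : Fin d → PowerSeries ℂ) :
    π (∑ l : Fin d, PowerSeries.C (c l) * PowerSeries.X ^ (l : ℕ)) =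
      ∑ l : Fin d, PowerSeries.C (PowerSeries.coeff 1 (c l)) * PowerSeries.X ^ (l : ℕ) := by
  rw [map_sum]
  refine Finset.sum_congr rfl fun l _ => PowerSeries.ext fun n => ?_
  rw [hπ, PowerSeries.coeff_C_mul_X_pow, PowerSeries.coeff_C_mul_X_pow]
  split_ifs
  · rfl
  · exact map_zero _

/-! ## The one-variable computation over `ℂ⟦w⟧⟦X⟧` -/

/-- Core computation over `B = ℂ⟦w⟧`: under the division identities every entry of `M` lies in
`(w)`, `det M (0) = 0`, and `[w^d] det M · c₀^d = (c₀ λ(f_{1,0}) - c₁ λ(f_{0,0}))^d`. -/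
theorem oneVariable (d : ℕ) (F₀ F₁ : PowerSeries (PowerSeries ℂ))
    (M : Matrix (Fin d) (Fin d) (PowerSeries ℂ)) (Q : Fin d → PowerSeries (PowerSeries ℂ))
    (hd : 1 ≤ d)
    (h0 : ∀ j < d, PowerSeries.constantCoeff (PowerSeries.coeff j F₀) = 0)
    (hc : PowerSeries.constantCoeff (PowerSeries.coeff d F₀) ≠ 0)
    (h1 : ∀ j < d, PowerSeries.constantCoeff (PowerSeries.coeff j F₁) = 0)
    (hdiv : ∀ j : Fin d, PowerSeries.X ^ (j : ℕ) * F₁ =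
      Q j * F₀ + ∑ l : Fin d, PowerSeries.C (M l j) * PowerSeries.X ^ (l : ℕ)) :
    PowerSeries.constantCoeff M.det = 0 ∧
      PowerSeries.coeff d M.det * PowerSeries.constantCoeff (PowerSeries.coeff d F₀) ^ d =
        (PowerSeries.constantCoeff (PowerSeries.coeff d F₀) *
            PowerSeries.coeff 1 (PowerSeries.coeff 0 F₁) -
          PowerSeries.constantCoeff (PowerSeries.coeff d F₁) *
            PowerSeries.coeff 1 (PowerSeries.coeff 0 F₀)) ^ d := by
  obtain ⟨π₀, hπ₀, hπ₀X, hπ₀C⟩ := exists_modW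
  obtain ⟨π, hπ⟩ := exists_linPart
  -- (α) reduction mod `w`: `π₀ F₀ = X^d u`, `π₀ F₁ = X^d v`
  obtain ⟨u, hu⟩ : (PowerSeries.X : PowerSeries ℂ) ^ d ∣ π₀ F₀ :=
    PowerSeries.X_pow_dvd_iff.mpr fun j hj => by rw [hπ₀]; exact h0 j hj
  obtain ⟨v, hv⟩ : (PowerSeries.X : PowerSeries ℂ) ^ d ∣ π₀ F₁ :=
    PowerSeries.X_pow_dvd_iff.mpr fun j hj => by rw [hπ₀]; exact h1 j hj
  have hu0 : PowerSeries.constantCoeff u = PowerSeries.constantCoeff (PowerSeries.coeff d F₀) := by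
    rw [← hπ₀, hu, coeff_X_pow_mul_self]
  have hv0 : PowerSeries.constantCoeff v = PowerSeries.constantCoeff (PowerSeries.coeff d F₁) := by
    rw [← hπ₀, hv, coeff_X_pow_mul_self]
  have hune : PowerSeries.constantCoeff u ≠ 0 := by rw [hu0]; exact hc
  have hred : ∀ j : Fin d, PowerSeries.X ^ d * (PowerSeries.X ^ (j : ℕ) * v) =
      PowerSeries.X ^ d * (π₀ (Q j) * u) +
        ∑ l : Fin d, PowerSeries.C (PowerSeries.constantCoeff (M l j)) *
          PowerSeries.X ^ (l : ℕ) := by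
    intro j
    have h := congrArg π₀ (hdiv j)
    simp only [map_mul, map_pow, map_add, map_sum, hπ₀X, hπ₀C] at h
    rw [hu, hv] at h
    calc PowerSeries.X ^ d * (PowerSeries.X ^ (j : ℕ) * v)
        = PowerSeries.X ^ (j : ℕ) * (PowerSeries.X ^ d * v) := by ring
      _ = _ := h
      _ = _ := by ring
  -- all entries of `M` vanish at `w = 0`
  have hM0 : ∀ l j : Fin d, PowerSeries.constantCoeff (M l j) = 0 := by
    intro l j
    have h := congrArg (PowerSeries.coeff (l : ℕ)) (hred j)
    rw [map_add, coeff_X_pow_mul_of_lt _ l.2, coeff_X_pow_mul_of_lt _ l.2, coeff_sum_C_mul_X_pow,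
      zero_add] at h
    exact h.symm
  -- the reduced quotients
  have hq : ∀ j : Fin d, π₀ (Q j) = PowerSeries.X ^ (j : ℕ) * (v * u⁻¹) := by
    intro j
    have h := hred j
    have hsum : ∑ l : Fin d, PowerSeries.C (PowerSeries.constantCoeff (M l j)) *
        PowerSeries.X ^ (l : ℕ) = 0 :=
      Finset.sum_eq_zero fun l _ => by rw [hM0, map_zero, zero_mul]
    rw [hsum, add_zero] at h
    have h' : PowerSeries.X ^ (j : ℕ) * v = π₀ (Q j) * u := PowerSeries.X_pow_mul_cancel h
    calc π₀ (Q j) = π₀ (Q j) * u * u⁻¹ := by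
          rw [mul_assoc, PowerSeries.mul_inv_cancel u hune, mul_one]
      _ = PowerSeries.X ^ (j : ℕ) * v * u⁻¹ := by rw [h']
      _ = _ := mul_assoc _ _ _
  -- (β) the `w`-linear parts of the division identities
  have hlin : ∀ j : Fin d, PowerSeries.X ^ (j : ℕ) * π F₁ =
      PowerSeries.X ^ (j : ℕ) * (v * u⁻¹ * π F₀) + PowerSeries.X ^ d * (π (Q j) * u) +
        ∑ l : Fin d, PowerSeries.C (PowerSeries.coeff 1 (M l j)) * PowerSeries.X ^ (l : ℕ) := by
    intro j
    have h := congrArg π (hdiv j)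
    rw [linPart_X_pow_mul π hπ, map_add, linPart_mul π₀ hπ₀ π hπ, linPart_sum_C_mul_X_pow π hπ,
      hq, hu] at h
    rw [h]
    ring
  -- the matrix of linear parts is lower triangular ...
  have hE_lt : ∀ l j : Fin d, l < j → PowerSeries.coeff 1 (M l j) = 0 := by
    intro l j hlj
    have hlj' : (l : ℕ) < (j : ℕ) := Fin.lt_def.mp hlj
    have h := congrArg (PowerSeries.coeff (l : ℕ)) (hlin j)
    rw [map_add, map_add, coeff_X_pow_mul_of_lt _ hlj', coeff_X_pow_mul_of_lt _ hlj',
      coeff_X_pow_mul_of_lt _ l.2, coeff_sum_C_mul_X_pow, zero_add, zero_add] at h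
    exact h.symm
  -- ... with constant diagonal `L = λ(f_{1,0}) - c₁ c₀⁻¹ λ(f_{0,0})`
  have hE_diag : ∀ j : Fin d, PowerSeries.coeff 1 (M j j) =
      PowerSeries.coeff 1 (PowerSeries.coeff 0 F₁) -
        PowerSeries.constantCoeff (PowerSeries.coeff d F₁) *
            (PowerSeries.constantCoeff (PowerSeries.coeff d F₀))⁻¹ *
          PowerSeries.coeff 1 (PowerSeries.coeff 0 F₀) := by
    intro j
    have h := congrArg (PowerSeries.coeff (j : ℕ)) (hlin j)
    rw [map_add, map_add, coeff_X_pow_mul_self, coeff_X_pow_mul_self,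
      coeff_X_pow_mul_of_lt _ j.2, coeff_sum_C_mul_X_pow, add_zero, map_mul, map_mul,
      PowerSeries.constantCoeff_inv, hu0, hv0,
      ← PowerSeries.coeff_zero_eq_constantCoeff_apply (π F₁), hπ,
      ← PowerSeries.coeff_zero_eq_constantCoeff_apply (π F₀), hπ] at h
    linear_combination -h
  -- (γ) `M = w • N`, `det M = w^d det N`
  choose N hN using fun l j : Fin d =>
    show ∃ c, M l j = PowerSeries.X * c from PowerSeries.X_dvd_iff.mpr (hM0 l j)
  have hMN : M = (PowerSeries.X : PowerSeries ℂ) • Matrix.of N := by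
    refine Matrix.ext fun l j => ?_
    rw [Matrix.smul_apply, Matrix.of_apply, smul_eq_mul]
    exact hN l j
  have hN0 : ∀ l j : Fin d, PowerSeries.constantCoeff (N l j) = PowerSeries.coeff 1 (M l j) := by
    intro l j
    have h := PowerSeries.coeff_succ_X_mul 0 (N l j)
    rw [zero_add, ← hN] at h
    rw [h, PowerSeries.coeff_zero_eq_constantCoeff_apply]
  have hdet : M.det = PowerSeries.X ^ d * (Matrix.of N).det := by
    rw [hMN, Matrix.det_smul, Fintype.card_fin]
  have hE : (PowerSeries.constantCoeff (R := ℂ)).mapMatrix (Matrix.of N) =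
      Matrix.of fun l j : Fin d => PowerSeries.coeff 1 (M l j) := by
    refine Matrix.ext fun l j => ?_
    rw [RingHom.mapMatrix_apply, Matrix.map_apply, Matrix.of_apply, Matrix.of_apply, hN0]
  have htri : (Matrix.of fun l j : Fin d => PowerSeries.coeff 1 (M l j)).BlockTriangular
      OrderDual.toDual := by
    intro l j hlj
    exact hE_lt l j (OrderDual.toDual_lt_toDual.mp hlj)
  have hdetN : PowerSeries.constantCoeff (Matrix.of N).det =
      (PowerSeries.coeff 1 (PowerSeries.coeff 0 F₁) -
        PowerSeries.constantCoeff (PowerSeries.coeff d F₁) *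
            (PowerSeries.constantCoeff (PowerSeries.coeff d F₀))⁻¹ *
          PowerSeries.coeff 1 (PowerSeries.coeff 0 F₀)) ^ d := by
    rw [RingHom.map_det, hE, Matrix.det_of_lowerTriangular _ htri]
    simp only [Matrix.of_apply, hE_diag]
    rw [Finset.prod_const, Finset.card_univ, Fintype.card_fin]
  refine ⟨?_, ?_⟩
  · rw [hdet, map_mul, map_pow, PowerSeries.constantCoeff_X, zero_pow (by omega), zero_mul]
  · rw [hdet, coeff_X_pow_mul_self, hdetN, ← mul_pow]
    congr 1
    have hinv : (PowerSeries.constantCoeff (PowerSeries.coeff d F₀))⁻¹ *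
        PowerSeries.constantCoeff (PowerSeries.coeff d F₀) = 1 := inv_mul_cancel₀ hc
    linear_combination (-(PowerSeries.constantCoeff (PowerSeries.coeff d F₁) *
      PowerSeries.coeff 1 (PowerSeries.coeff 0 F₀))) * hinv

end CorankOneLeadingForm

/-- **Leading form of the Weierstrass eliminant** (helper piece 3b of the stub
`stub_shallowCorankOne`).  For `F₀, F₁ ∈ A⟦X⟧`, `A = ℂ⟦W_0, …, W_{m-1}⟧`, with `f_{a,j}(0) = 0` for
`j < d` and `c₀ := f_{0,d}(0) ≠ 0`, and ANY matrix `M` and quotients `Q_j` with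
`X^j F₁ = Q_j F₀ + Σ_l C(M_{lj}) X^l` (`j < d`): `det M (0) = 0` and
`coeff_{W_i^d}(det M) · c₀^d = (c₀ λ_i(f_{1,0}) - c₁ λ_i(f_{0,0}))^d` (`c₁ := f_{1,d}(0)`,
`λ_i` = coefficient of `W_i`). -/
theorem corankOne_eliminantLeadingForm :
    ∀ (m d : ℕ) (F₀ F₁ : PowerSeries (MvPowerSeries (Fin m) ℂ))
      (M : Matrix (Fin d) (Fin d) (MvPowerSeries (Fin m) ℂ)) (Q : Fin d → PowerSeries (MvPowerSeries (Fin m) ℂ))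
      (i : Fin m), 1 ≤ d →
      (∀ j < d, MvPowerSeries.constantCoeff (PowerSeries.coeff j F₀) = 0) →
      MvPowerSeries.constantCoeff (PowerSeries.coeff d F₀) ≠ 0 →
      (∀ j < d, MvPowerSeries.constantCoeff (PowerSeries.coeff j F₁) = 0) →
      (∀ j : Fin d, PowerSeries.X ^ (j : ℕ) * F₁ =
        Q j * F₀ + ∑ l : Fin d, PowerSeries.C (M l j) * PowerSeries.X ^ (l : ℕ)) →
      MvPowerSeries.constantCoeff M.det = 0 ∧
        MvPowerSeries.coeff (Finsupp.single i d) M.det *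
            MvPowerSeries.constantCoeff (PowerSeries.coeff d F₀) ^ d =
          (MvPowerSeries.constantCoeff (PowerSeries.coeff d F₀) *
              MvPowerSeries.coeff (Finsupp.single i 1) (PowerSeries.coeff 0 F₁) -
            MvPowerSeries.constantCoeff (PowerSeries.coeff d F₁) *
              MvPowerSeries.coeff (Finsupp.single i 1) (PowerSeries.coeff 0 F₀)) ^ d := by
  intro m d F₀ F₁ M Q i hd h0 hc h1 hdiv
  obtain ⟨ρ, hρ⟩ := CorankOneLeadingForm.exists_axisHom i
  have hρ0 := CorankOneLeadingForm.axisHom_constantCoeff ρ hρ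
  have key := CorankOneLeadingForm.oneVariable d (PowerSeries.map ρ F₀) (PowerSeries.map ρ F₁)
    (M.map ρ) (fun j => PowerSeries.map ρ (Q j)) hd
    (fun j hj => by rw [PowerSeries.coeff_map, hρ0]; exact h0 j hj)
    (by rw [PowerSeries.coeff_map, hρ0]; exact hc)
    (fun j hj => by rw [PowerSeries.coeff_map, hρ0]; exact h1 j hj)
    (fun j => by
      simpa only [map_mul, map_pow, map_add, map_sum, PowerSeries.map_X, PowerSeries.map_C,
        Matrix.map_apply] using congrArg (PowerSeries.map ρ) (hdiv j))
  have hdet : (M.map ρ).det = ρ M.det := by rw [RingHom.map_det, RingHom.mapMatrix_apply]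
  simp only [PowerSeries.coeff_map, hdet, hρ0, hρ] at key
  exact key

end Summit.ValiantsHypothesis.ValiantsHypothesis.Theorems.BinomialCandidateStubs
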